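import Mathlib
import Literature.MathematicalPhysics.StatisticalMechanics.Crystallization
import Literature.MathematicalPhysics.StatisticalMechanics.LennardJonesClusters

/-!
# Crux `ExactCertificate` (stmt-AtomisticToContinuum-11959), line `closure-makes-nogap-exact`,
# Transfer1D skeleton (`ExactCertificate1D`): the stub `stub_chainEnergy`

Support file — nothing here closes an item.  The d = 1 transfer skeleton of the crux
`ThreeConeCertificate.ExactCertificate` gives the lower bound `N · e(aℤ) ≤ 𝓔_N(x)`; its energetic
corollary `HasPeriodicGroundStateEnergy lennardJones 1` (wave 2) also needs the matching upper
bound, by the obvious trial state of `N` equally spaced points `x_i = i · a` on the line.  This file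
supplies the bookkeeping stub

`stub_chainEnergy : ∀ a > 0, ∀ N, (i ↦ (i a) e₀) injective ∧
  𝓔_N(i ↦ (i a) e₀) = Σ_{d < N} (N - d) · V(d a)`, `V = lennardJones`:

the mutual distances are `dist((i a) e₀, (j a) e₀) = (j - i) a` for `i < j`, there are exactly
`N - d` pairs `i < j` with `j - i = d` (`1 ≤ d < N`), and the `d = 0` term vanishes because
`V(0) = 0` (Lean's `0⁻¹ = 0`).  The pair count is done by induction on `N`
(`Fin.sum_univ_castSucc`: adding the point `x_N` adds
`Σ_{i < N} V((N - i) a) = Σ_{1 ≤ d ≤ N} V(d a)`).  All `[folklore]`.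
-/

noncomputable section

namespace Summit.AtomisticToContinuum.Crystallization.Theorems.ThreeConeCertificateExactCertificate.Transfer1D

open Literature.MathematicalPhysics.StatisticalMechanics

/-- Peeling off the last point: a sum over the pairs `i < j` in `Fin (N + 1)` of a function of the
indices is the same sum over the pairs in `Fin N` plus the pairs `(i, N)`, `i < N`. [folklore] -/
theorem chainEnergy_sum_Ioi_succ (g : ℕ → ℕ → ℝ) (N : ℕ) :
    ∑ i : Fin (N + 1), ∑ j ∈ Finset.Ioi i, g i j =
      ∑ i : Fin N, ∑ j ∈ Finset.Ioi i, g i j + ∑ i : Fin N, g i N := by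
  have key : ∀ (M : ℕ) (i : Fin M) (h : Fin M → ℝ),
      ∑ j ∈ Finset.Ioi i, h j = ∑ j, if i < j then h j else 0 := by
    intro M i h
    rw [← Finset.sum_filter, Finset.filter_lt_eq_Ioi]
  simp_rw [key]
  rw [Fin.sum_univ_castSucc]
  simp only [Fin.sum_univ_castSucc, Fin.castSucc_lt_castSucc_iff, Fin.castSucc_lt_last, if_true,
    Fin.val_castSucc, Fin.val_last, lt_self_iff_false, if_false, add_zero, Finset.sum_add_distrib]
  have : ∑ j : Fin N, (if Fin.last N < Fin.castSucc j then g N j else 0) = 0 :=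
    Finset.sum_eq_zero fun j _ => if_neg (not_lt.2 (Fin.castSucc_lt_last j).le)
  rw [this, add_zero]

/-- The pair count: `Σ_{i < j < N} φ(j - i) = Σ_{d < N} (N - d) φ(d)` when `φ(0) = 0` (there are
`N - d` pairs at index distance `d ≥ 1`). [folklore] -/
theorem chainEnergy_sum_pairs (φ : ℕ → ℝ) (h0 : φ 0 = 0) : ∀ N : ℕ,
    ∑ i : Fin N, ∑ j ∈ Finset.Ioi i, φ (j - i) = ∑ d ∈ Finset.range N, ((N : ℝ) - d) * φ d
  | 0 => by simp
  | N + 1 => by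
    rw [chainEnergy_sum_Ioi_succ (fun i j => φ (j - i)), chainEnergy_sum_pairs φ h0 N]
    -- the new pairs `(i, N)` contribute `Σ_{i < N} φ (N - i) = Σ_{d < N} φ (d + 1)`
    have hnew : ∑ i : Fin N, φ (N - i) = ∑ d ∈ Finset.range N, φ (d + 1) := by
      rw [Fin.sum_univ_eq_sum_range (fun i => φ (N - i)) N, ← Finset.sum_range_reflect]
      exact Finset.sum_congr rfl fun d hd => by
        rw [Finset.mem_range] at hd
        congr 1
        omega
    have hsplit : ∀ d ∈ Finset.range (N + 1),
        (((N + 1 : ℕ) : ℝ) - d) * φ d = ((N : ℝ) - d) * φ d + φ d := by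
      intro d _; push_cast; ring
    rw [hnew, Finset.sum_congr rfl hsplit, Finset.sum_add_distrib,
      Finset.sum_range_succ (fun d => ((N : ℝ) - d) * φ d) N,
      Finset.sum_range_succ' (fun d => φ d) N, h0, sub_self, zero_mul, add_zero, add_zero]

/-- **The equally spaced trial state.**  For `a > 0` the configuration `x_i = (i a) e₀`
(`i < N`) of the line consists of distinct points and its Lennard-Jones energy is
`𝓔_N(x) = Σ_{d < N} (N - d) V(d a)` (`N - d` pairs at distance `d a`; the `d = 0` term is
`0` since `V(0) = 0`). [folklore] -/
theorem stub_chainEnergy : ∀ a : ℝ, 0 < a → ∀ N : ℕ,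
    Function.Injective (fun i : Fin N => EuclideanSpace.single (0 : Fin 1) ((i : ℝ) * a)) ∧
    interactionEnergy lennardJones (fun i : Fin N => EuclideanSpace.single (0 : Fin 1) ((i : ℝ) * a)) =
      ∑ d ∈ Finset.range N, ((N : ℝ) - d) * lennardJones (d * a) := by
  intro a ha N
  refine ⟨fun i j h => ?_, ?_⟩
  · have h0 := congrArg (fun v : EuclideanSpace ℝ (Fin 1) => v 0) h
    simp only [PiLp.single_apply, if_true] at h0
    exact Fin.ext (Nat.cast_injective (R := ℝ) (mul_right_cancel₀ ha.ne' h0))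
  · have hφ0 : (fun d : ℕ => lennardJones (d * a)) 0 = 0 := by
      simp [lennardJones_zero]
    rw [← chainEnergy_sum_pairs (fun d : ℕ => lennardJones (d * a)) hφ0 N, interactionEnergy]
    refine Finset.sum_congr rfl fun i _ => Finset.sum_congr rfl fun j hj => ?_
    have hij : i < j := Finset.mem_Ioi.1 hj
    congr 1
    rw [EuclideanSpace.single, PiLp.dist_single_same, Real.dist_eq, ← sub_mul, abs_mul,
      abs_of_pos ha, abs_sub_comm, Nat.cast_sub hij.le, abs_of_nonneg]
    exact sub_nonneg.2 (Nat.cast_le.2 hij.le)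

end Summit.AtomisticToContinuum.Crystallization.Theorems.ThreeConeCertificateExactCertificate.Transfer1D

end
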